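import Mathlib
import Summits.ValiantsHypothesis.ValiantsHypothesis.Theorems.KPlusLogSqLawWeakLiftingTowerGraftRankOneGraft
import Summits.ValiantsHypothesis.ValiantsHypothesis.Theorems.LacunarySymmetroidMatrixDescartesDegreeCeiling

/-!
# Tower graft line — SECTOR-FREE DIGITS ⇒ ONE CROSSING (the zeroth instance of T1 «log-slope localisation»)

Mechanism file for the line `Cruxes/WeakLifting/Lines/tower_graft.lean` (crux `WeakLifting` = stmt-ValiantsHypothesis-19561,
memo `Cruxes/WeakLifting/Lines/tower_graft-S5.md` §1 (E0)/(Er)/(Ec), §3 T1/T2); S4b/S5 side, NO stub is claimed.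

THE LEMMA (`card_posRoots_add_X_pow_mul_le_one`).  Let `A, E ∈ ℝ[X]` be non-zero and let `0 < s ≤ 1` (read `s = sin ω`).
Suppose every complex root `z` of `A` and of `E` lies OUTSIDE the open sector `{z ≠ 0 : |arg z| < ω}` — typed without
trigonometry as `s·‖z‖ ≤ |Im z| ∨ Re z ≤ 0` — and that the graft exponent is steep against the digit degrees,
`natDegree A + natDegree E < s·D`.  Then the two-digit graft `A + X^D·E` has AT MOST ONE positive root.

Proof.  Over `ℂ`, `t·A′(t)/A(t) = Σ_{z ∈ roots A} t/(t − z)` (`Polynomial.Splits.eval_derivative_div_eval_of_ne_zero`), and a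
point `z` off the sector is at distance `≥ t·s` from every `t > 0` (`mul_le_norm_sub_of_offSector`: with `|Re z| ≤ cos ω·‖z‖`,
`‖t − z‖² − t²sin²ω = (t cos ω)² − 2t·Re z + ‖z‖² ≥ (t cos ω − ‖z‖)²`), so `|t·A′/A| ≤ deg A / s` on `(0,∞)`
(`abs_mul_logDeriv_le_of_offSector`) — the LOG-SLOPE of a sector-free digit never exceeds `deg/s`.  Hence
`ψ(t) = log|A(t)| − D·log t − log|E(t)|` has `t·ψ′(t) ≤ (deg A + deg E)/s − D < 0`: `ψ` is strictly antitone on `(0,∞)`,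
and every positive root of `A + X^D E` satisfies `|A(t)| = t^D |E(t)|`, i.e. `ψ(t) = 0`.

MEANING FOR THE LINE (honest).  For the corner graft `det G + X^D·det G₀₀` (`det_add_smul_single_zero`, lift-p3 g16) on a support
with exponents `≤ dmax` and size `m+1`, the digit degrees are `≤ (m+1)·dmax` and `≤ m·dmax` (`DegreeCeiling.natDegree_det_pencil_le`),
so at steepness `(2m+1)·dmax < s·D` the corner graft has at most ONE positive zero UNLESS one of the two class determinants
`det G`, `det G₀₀` has a zero inside the sector of half-angle `arcsin s` around the positive axis
(`card_posRoots_cornerGraft_le_one_of_offSector`).  Every positive zero beyond the first is therefore CHARGED TO AN IN-SECTOR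
(«near-axis», memo (Ec)) zero of `det G · det G₀₀` — the kernel form of «events = near-axis zeros of the class»; counting those
against the class budget is the memo's T2 (thin-sector class law), which is OPEN and not touched here.  Nothing in this file bears
on S4 (`TowerGraftLawId`), S4b (`TowerGraftLawCorner`), S5, TowerB, `WeakLifting`, Conjecture B, `MatrixDescartes` (18050) or
`VP ≠ VNP`.  Def-free.  Seat: prover val-sym-lift-p1 g20, `--supports stmt-ValiantsHypothesis-19561`.
-/

-- `Summit.ValiantsHypothesis.ValiantsHypothesis.…` repeats a component by the D-0017 layout
-- (single-conjunct summit), which the `dupNamespace` linter flags; the name is mandated.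
set_option linter.dupNamespace false

namespace Summit.ValiantsHypothesis.ValiantsHypothesis.Theorems.KPlusLogSqLaw.TowerGraft

open Polynomial
open scoped BigOperators Polynomial

/-! ## §1 Off-sector geometry: a point off the sector `|arg z| < arcsin s` is at distance `≥ t·s` from every `t > 0` -/

section Sector

/-- **off-sector distance bound.**  If `s·‖z‖ ≤ |Im z|` or `Re z ≤ 0` (i.e. `z` lies outside the open sector of half-angle
`arcsin s` around the positive real axis, `0 ≤ s ≤ 1`), then `t·s ≤ ‖t − z‖` for every real `t ≥ 0`. [folklore] -/
theorem mul_le_norm_sub_of_offSector {s : ℝ} (hs : 0 ≤ s) (hs1 : s ≤ 1) {t : ℝ} (ht : 0 ≤ t) {z : ℂ}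
    (hz : s * ‖z‖ ≤ |z.im| ∨ z.re ≤ 0) : t * s ≤ ‖(t : ℂ) - z‖ := by
  have hnorm : ‖(t : ℂ) - z‖ ^ 2 = (t - z.re) ^ 2 + z.im ^ 2 := by
    rw [Complex.sq_norm, Complex.normSq_apply]
    simp only [Complex.sub_re, Complex.ofReal_re, Complex.sub_im, Complex.ofReal_im, zero_sub]
    ring
  have hts : 0 ≤ t * s := mul_nonneg ht hs
  have hn0 : 0 ≤ ‖(t : ℂ) - z‖ := norm_nonneg _
  suffices hsq : (t * s) ^ 2 ≤ ‖(t : ℂ) - z‖ ^ 2 by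
    have := abs_le_of_sq_le_sq hsq hn0
    rwa [abs_of_nonneg hts] at this
  rw [hnorm]
  rcases hz with hz | hz
  · -- `|Re z| ≤ c·‖z‖` with `c = √(1 − s²)`, then complete the square
    set r : ℝ := ‖z‖ with hr
    have hr0 : 0 ≤ r := norm_nonneg z
    have hr2 : r ^ 2 = z.re ^ 2 + z.im ^ 2 := by
      rw [hr, Complex.sq_norm, Complex.normSq_apply]; ring
    set c : ℝ := Real.sqrt (1 - s ^ 2) with hc
    have hc0 : 0 ≤ c := Real.sqrt_nonneg _
    have hc2 : c ^ 2 = 1 - s ^ 2 := by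
      rw [hc, Real.sq_sqrt]; nlinarith
    have him2 : (s * r) ^ 2 ≤ z.im ^ 2 := by
      have h0 : 0 ≤ s * r := mul_nonneg hs hr0
      calc (s * r) ^ 2 ≤ |z.im| ^ 2 := pow_le_pow_left₀ h0 hz 2
        _ = z.im ^ 2 := sq_abs _
    have hre2 : z.re ^ 2 ≤ (r * c) ^ 2 := by nlinarith
    have hre : z.re ≤ r * c := by
      have := abs_le_of_sq_le_sq hre2 (mul_nonneg hr0 hc0)
      exact (le_abs_self _).trans this
    have hs2 : (t * s) ^ 2 = t ^ 2 - t ^ 2 * c ^ 2 := by rw [hc2]; ring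
    have hb2 : z.im ^ 2 = r ^ 2 - z.re ^ 2 := by rw [hr2]; ring
    rw [hs2, hb2]
    nlinarith [sq_nonneg (t * c - r), mul_nonneg ht (sub_nonneg.mpr hre)]
  · -- `Re z ≤ 0`: `‖t − z‖ ≥ t − Re z ≥ t ≥ t·s`
    nlinarith [sq_nonneg z.im, mul_nonneg ht (sub_nonneg.mpr hs1), mul_nonneg ht hs, mul_nonneg ht (neg_nonneg.mpr hz)]

/-- the off-sector condition excludes the positive reals themselves. [folklore] -/
theorem not_offSector_of_pos {s : ℝ} (hs : 0 < s) {t : ℝ} (ht : 0 < t) :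
    ¬ (s * ‖(t : ℂ)‖ ≤ |(t : ℂ).im| ∨ (t : ℂ).re ≤ 0) := by
  rintro (h | h)
  · rw [Complex.ofReal_im, abs_zero, Complex.norm_real, Real.norm_eq_abs, abs_of_pos ht] at h
    nlinarith [mul_pos hs ht]
  · rw [Complex.ofReal_re] at h
    exact absurd h (not_le.mpr ht)

end Sector

/-! ## §2 The log-slope of a sector-free real polynomial on `(0,∞)` is at most `deg / s` -/

section LogSlope

/-- a sector-free real polynomial does not vanish on `(0,∞)`.  (The evaluation identity
`(A.map ofRealHom).eval ↑t = ↑(A.eval t)` is the tree's `Literature.NumberTheory.LFunctions.eval_map_ofRealHom`;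
it is re-derived inline by `eval_map`/`eval₂_at_apply` to keep this file's imports inside the summit.) [folklore] -/
theorem eval_ne_zero_of_offSector {s : ℝ} (hs : 0 < s) (A : ℝ[X]) (hA : A ≠ 0)
    (hroots : ∀ z ∈ (A.map Complex.ofRealHom).roots, s * ‖z‖ ≤ |z.im| ∨ z.re ≤ 0)
    {t : ℝ} (ht : 0 < t) : A.eval t ≠ 0 := by
  intro h0
  have hAc : A.map Complex.ofRealHom ≠ 0 := (Polynomial.map_ne_zero_iff Complex.ofRealHom.injective).mpr hA
  have hmem : (t : ℂ) ∈ (A.map Complex.ofRealHom).roots := by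
    rw [Polynomial.mem_roots hAc, Polynomial.IsRoot.def, Polynomial.eval_map, ← Complex.ofRealHom_eq_coe,
      Polynomial.eval₂_at_apply, h0, map_zero]
  exact not_offSector_of_pos hs ht (hroots _ hmem)

/-- **LOG-SLOPE BOUND.**  If every complex root of the non-zero real polynomial `A` lies off the sector
(`s·‖z‖ ≤ |Im z| ∨ Re z ≤ 0`, `0 < s ≤ 1`), then for every `t > 0`:
`|t · A′(t) / A(t)| ≤ natDegree A / s` — since `t·A′/A = Σ_z t/(t − z)` and `‖t − z‖ ≥ t·s`. [folklore] -/
theorem abs_mul_logDeriv_le_of_offSector {s : ℝ} (hs : 0 < s) (hs1 : s ≤ 1) (A : ℝ[X]) (hA : A ≠ 0)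
    (hroots : ∀ z ∈ (A.map Complex.ofRealHom).roots, s * ‖z‖ ≤ |z.im| ∨ z.re ≤ 0)
    {t : ℝ} (ht : 0 < t) :
    |t * (A.derivative.eval t / A.eval t)| ≤ A.natDegree / s := by
  set Ac : ℂ[X] := A.map Complex.ofRealHom with hAcdef
  have hev : ∀ Q : ℝ[X], (Q.map Complex.ofRealHom).eval (t : ℂ) = ((Q.eval t : ℝ) : ℂ) := fun Q => by
    rw [Polynomial.eval_map, ← Complex.ofRealHom_eq_coe, Polynomial.eval₂_at_apply, Complex.ofRealHom_eq_coe]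
  have hAt : A.eval t ≠ 0 := eval_ne_zero_of_offSector hs A hA hroots ht
  have hAct : Ac.eval (t : ℂ) ≠ 0 := by
    rw [hAcdef, hev]; exact_mod_cast hAt
  have hsplit : Ac.Splits := IsAlgClosed.splits Ac
  have hform := hsplit.eval_derivative_div_eval_of_ne_zero hAct
  have hder : Ac.derivative.eval (t : ℂ) = ((A.derivative.eval t : ℝ) : ℂ) := by
    rw [hAcdef, Polynomial.derivative_map, hev]
  rw [hder, hAcdef, hev, ← Complex.ofReal_div] at hform
  -- `↑(t · A′/A) = Σ_z t/(t − z)`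
  have hsum : ((t * (A.derivative.eval t / A.eval t) : ℝ) : ℂ) =
      (Ac.roots.map fun z => (t : ℂ) * (1 / ((t : ℂ) - z))).sum := by
    rw [Multiset.sum_map_mul_left, ← hform, Complex.ofReal_mul]
  -- norms
  have hcard : (Multiset.card Ac.roots : ℝ) = A.natDegree := by
    rw [← hsplit.natDegree_eq_card_roots, hAcdef,
      Polynomial.natDegree_map_eq_of_injective Complex.ofRealHom.injective]
  have hterm : ∀ z ∈ Ac.roots, ‖(t : ℂ) * (1 / ((t : ℂ) - z))‖ ≤ 1 / s := by
    intro z hz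
    have hdist : t * s ≤ ‖(t : ℂ) - z‖ := mul_le_norm_sub_of_offSector hs.le hs1 ht.le (hroots z hz)
    have hts : 0 < t * s := mul_pos ht hs
    rw [norm_mul, norm_div, norm_one, Complex.norm_real, Real.norm_eq_abs, abs_of_pos ht, ← div_eq_mul_one_div]
    calc t / ‖(t : ℂ) - z‖ ≤ t / (t * s) := div_le_div_of_nonneg_left ht.le hts hdist
      _ = 1 / s := by field_simp
  calc |t * (A.derivative.eval t / A.eval t)|
      = ‖((t * (A.derivative.eval t / A.eval t) : ℝ) : ℂ)‖ := by
          rw [Complex.norm_real, Real.norm_eq_abs]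
    _ = ‖(Ac.roots.map fun z => (t : ℂ) * (1 / ((t : ℂ) - z))).sum‖ := by rw [hsum]
    _ ≤ ((Ac.roots.map fun z => (t : ℂ) * (1 / ((t : ℂ) - z))).map fun x => ‖x‖).sum :=
          norm_multiset_sum_le _
    _ = (Ac.roots.map fun z => ‖(t : ℂ) * (1 / ((t : ℂ) - z))‖).sum := by rw [Multiset.map_map]; rfl
    _ ≤ (Ac.roots.map fun _ => 1 / s).sum := Multiset.sum_map_le_sum_map _ _ hterm
    _ = (Multiset.card Ac.roots : ℝ) * (1 / s) := by
          rw [Multiset.map_const', Multiset.sum_replicate, nsmul_eq_mul]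
    _ = A.natDegree / s := by rw [hcard, ← div_eq_mul_one_div]

end LogSlope

/-! ## §3 Sector-free digits ⇒ the graft `A + X^D·E` has at most one positive root -/

section Graft

/-- the potential `ψ(t) = log|A(t)| − D·log t − log|E(t)|` (inlined below as a lambda) vanishes at every positive root of
`A + X^D·E`. [folklore] -/
theorem log_potential_eq_zero_of_root (A E : ℝ[X]) (D : ℕ) {t : ℝ} (ht : 0 < t) (hEt : E.eval t ≠ 0)
    (hroot : (A + X ^ D * E).eval t = 0) :
    Real.log (A.eval t) - D * Real.log t - Real.log (E.eval t) = 0 := by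
  have hA : A.eval t = -(t ^ D * E.eval t) := by
    rw [Polynomial.eval_add, Polynomial.eval_mul, Polynomial.eval_pow, Polynomial.eval_X] at hroot
    linarith
  have habs : |A.eval t| = t ^ D * |E.eval t| := by
    rw [hA, abs_neg, abs_mul, abs_of_pos (pow_pos ht D)]
  rw [← Real.log_abs (A.eval t), ← Real.log_abs (E.eval t), habs,
    Real.log_mul (pow_pos ht D).ne' (abs_pos.mpr hEt).ne', Real.log_pow]
  ring

/-- **SECTOR-FREE DIGITS ⇒ ONE CROSSING.**  Let `A, E ∈ ℝ[X]` be non-zero, `0 < s ≤ 1`, every complex root `z` of `A`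
and of `E` off the sector (`s·‖z‖ ≤ |Im z| ∨ Re z ≤ 0`, i.e. outside `{|arg z| < arcsin s}`), and
`natDegree A + natDegree E < s·D`.  Then `A + X^D·E` has at most one positive root: the log-slopes of the digits are
`≤ deg/s` (§2), so `log|A| − D log t − log|E|` is strictly antitone on `(0,∞)` and vanishes at every positive root. [this work] -/
theorem card_posRoots_add_X_pow_mul_le_one {s : ℝ} (hs : 0 < s) (hs1 : s ≤ 1) (A E : ℝ[X]) (D : ℕ)
    (hA : A ≠ 0) (hE : E ≠ 0)
    (hrA : ∀ z ∈ (A.map Complex.ofRealHom).roots, s * ‖z‖ ≤ |z.im| ∨ z.re ≤ 0)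
    (hrE : ∀ z ∈ (E.map Complex.ofRealHom).roots, s * ‖z‖ ≤ |z.im| ∨ z.re ≤ 0)
    (hdeg : (A.natDegree + E.natDegree : ℝ) < s * D) :
    ((A + X ^ D * E).roots.toFinset.filter (fun t => 0 < t)).card ≤ 1 := by
  -- the potential and its derivative on `(0,∞)`
  set ψ : ℝ → ℝ := fun t => Real.log (A.eval t) - D * Real.log t - Real.log (E.eval t) with hψ
  have hderiv : ∀ t : ℝ, 0 < t → HasDerivAt ψ
      (A.derivative.eval t / A.eval t - D * t⁻¹ - E.derivative.eval t / E.eval t) t := by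
    intro t ht
    have hAt := eval_ne_zero_of_offSector hs A hA hrA ht
    have hEt := eval_ne_zero_of_offSector hs E hE hrE ht
    have h1 : HasDerivAt (fun x => Real.log (A.eval x)) (A.derivative.eval t / A.eval t) t :=
      (Polynomial.hasDerivAt A t).log hAt
    have h2 : HasDerivAt (fun x => (D : ℝ) * Real.log x) ((D : ℝ) * t⁻¹) t :=
      (Real.hasDerivAt_log ht.ne').const_mul (D : ℝ)
    have h3 : HasDerivAt (fun x => Real.log (E.eval x)) (E.derivative.eval t / E.eval t) t :=
      (Polynomial.hasDerivAt E t).log hEt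
    exact (h1.sub h2).sub h3
  have hneg : ∀ t : ℝ, 0 < t →
      A.derivative.eval t / A.eval t - D * t⁻¹ - E.derivative.eval t / E.eval t < 0 := by
    intro t ht
    have hbA := abs_mul_logDeriv_le_of_offSector hs hs1 A hA hrA ht
    have hbE := abs_mul_logDeriv_le_of_offSector hs hs1 E hE hrE ht
    have hsum : t * (A.derivative.eval t / A.eval t) - t * (E.derivative.eval t / E.eval t) < D := by
      have h1 := le_abs_self (t * (A.derivative.eval t / A.eval t))
      have h2 := neg_abs_le (t * (E.derivative.eval t / E.eval t))
      have h3 : (A.natDegree : ℝ) / s + E.natDegree / s < D := by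
        rw [← add_div, div_lt_iff₀ hs]; linarith
      linarith
    have hkey : t * (A.derivative.eval t / A.eval t - D * t⁻¹ - E.derivative.eval t / E.eval t) < 0 := by
      have : t * (D * t⁻¹) = D := by field_simp
      nlinarith [this]
    by_contra hcon
    exact absurd hkey (not_lt.mpr (mul_nonneg ht.le (not_lt.mp hcon)))
  -- strictly antitone on `(0,∞)`
  have hanti : StrictAntiOn ψ (Set.Ioi 0) := by
    refine strictAntiOn_of_deriv_neg (convex_Ioi 0) ?_ ?_
    · intro t ht
      exact (hderiv t ht).continuousAt.continuousWithinAt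
    · intro t ht
      rw [interior_Ioi] at ht
      rw [(hderiv t ht).deriv]
      exact hneg t ht
  -- two positive roots would give `ψ t₁ = 0 = ψ t₂`
  refine Finset.card_le_one.mpr fun t₁ h₁ t₂ h₂ => ?_
  rw [Finset.mem_filter, Multiset.mem_toFinset] at h₁ h₂
  have hr₁ := (Polynomial.mem_roots'.mp h₁.1).2
  have hr₂ := (Polynomial.mem_roots'.mp h₂.1).2
  rw [Polynomial.IsRoot.def] at hr₁ hr₂
  have e₁ := log_potential_eq_zero_of_root A E D h₁.2 (eval_ne_zero_of_offSector hs E hE hrE h₁.2) hr₁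
  have e₂ := log_potential_eq_zero_of_root A E D h₂.2 (eval_ne_zero_of_offSector hs E hE hrE h₂.2) hr₂
  exact hanti.injOn h₁.2 h₂.2 (e₁.trans e₂.symm)

end Graft

/-! ## §4 The corner graft of the line: sector-free class determinants ⇒ at most one positive zero -/

section Corner

variable {m : ℕ}

/-- **CORNER GRAFT, SECTOR-FREE CASE.**  Let `G = Σₗ X^{dₗ} Sₗ` be a matrix pencil of size `m+1` with exponents `dₗ ≤ dmax`
(no symmetry, tower or budget hypothesis is needed here), and graft `X^D` onto the entry `(0,0)`:
`det (G + X^D·E₀₀) = det G + X^D·det G₀₀`.  If `det G ≠ 0`, `det G₀₀ ≠ 0`, every complex root of both lies off the sector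
`{|arg z| < arcsin s}` (`0 < s ≤ 1`) and `(2m+1)·dmax < s·D`, then the grafted determinant has AT MOST ONE positive zero.
So at this steepness every positive zero of a corner graft beyond the first is charged to an in-sector zero of `det G · det G₀₀`
(memo tower_graft-S5 §1 (Ec), §3 T1/T2).  [this work] -/
theorem card_posRoots_cornerGraft_le_one_of_offSector {K : ℕ} (d : Fin K → ℕ) (dmax D : ℕ) (hd : ∀ l, d l ≤ dmax)
    (S : Fin K → Matrix (Fin (m + 1)) (Fin (m + 1)) ℝ) {s : ℝ} (hs : 0 < s) (hs1 : s ≤ 1)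
    (hsteep : ((m + 1 + m) * dmax : ℝ) < s * D)
    (hG : (∑ l, ((X : ℝ[X]) ^ d l) • (S l).map C).det ≠ 0)
    (hG₀ : (∑ l, ((X : ℝ[X]) ^ d l) • ((S l).submatrix Fin.succ Fin.succ).map C).det ≠ 0)
    (hrG : ∀ z ∈ ((∑ l, ((X : ℝ[X]) ^ d l) • (S l).map C).det.map Complex.ofRealHom).roots,
      s * ‖z‖ ≤ |z.im| ∨ z.re ≤ 0)
    (hrG₀ : ∀ z ∈ ((∑ l, ((X : ℝ[X]) ^ d l) • ((S l).submatrix Fin.succ Fin.succ).map C).det.map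
      Complex.ofRealHom).roots, s * ‖z‖ ≤ |z.im| ∨ z.re ≤ 0) :
    (((∑ l, ((X : ℝ[X]) ^ d l) • (S l).map C) +
          (X : ℝ[X]) ^ D • Matrix.single (0 : Fin (m + 1)) (0 : Fin (m + 1)) (1 : ℝ[X])).det.roots.toFinset.filter
        (fun t => 0 < t)).card ≤ 1 := by
  set G := ∑ l, ((X : ℝ[X]) ^ d l) • (S l).map C with hGdef
  have hGsub : G.submatrix Fin.succ Fin.succ =
      ∑ l, ((X : ℝ[X]) ^ d l) • ((S l).submatrix Fin.succ Fin.succ).map C := by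
    refine Matrix.ext fun i j => ?_
    simp [hGdef, Matrix.submatrix_apply, Matrix.sum_apply, Matrix.smul_apply, Matrix.map_apply]
  rw [det_add_smul_single_zero, hGsub]
  have hdegA : (G.det.natDegree : ℝ) ≤ (m + 1) * dmax := by
    exact_mod_cast LacunarySymmetroidMatrixDescartes.DegreeCeiling.natDegree_det_pencil_le d S dmax hd
  have hdegE : ((∑ l, ((X : ℝ[X]) ^ d l) • ((S l).submatrix Fin.succ Fin.succ).map C).det.natDegree : ℝ)
      ≤ m * dmax := by
    exact_mod_cast LacunarySymmetroidMatrixDescartes.DegreeCeiling.natDegree_det_pencil_le d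
      (fun l => (S l).submatrix Fin.succ Fin.succ) dmax hd
  refine card_posRoots_add_X_pow_mul_le_one hs hs1 _ _ D hG hG₀ hrG hrG₀ ?_
  have : ((m : ℝ) + 1 + m) * dmax = (m + 1) * dmax + m * dmax := by ring
  linarith

end Corner

end Summit.ValiantsHypothesis.ValiantsHypothesis.Theorems.KPlusLogSqLaw.TowerGraft
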